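import Literature.MathematicalPhysics.QuantumLattice.FlatBandFerromagnetismKagome
import HarnessLib

/-!
# Saturated ferromagnetic ground states of flat-band Hubbard models for `N_e ≤ N_d`

Topic `MathematicalPhysics/QuantumLattice` (Hubbard family; rigorous ferromagnetism). A supplement to
Mielke's theorem (`FlatBandFerromagnetismMielke.lean`: at `N_e = N_d` the ground state is the UNIQUE
ferromagnetic multiplet iff the flat band is irreducible): the elementary half of the picture, valid for
EVERY electron number `N_e ≤ N_d` and without any irreducibility hypothesis —

> "A Hubbard model with a `N_d`-fold degenerate single-particle ground state has ferromagnetic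
> ground states if the number of electrons is less or equal to `N_d`" [Mielke 1999, abstract];
> "Any multi particle state that contains only electrons with spin up in single particle states
> `φ^i`, `i ≤ N_d` is a ground state … It is even a ground state of the kinetic part and of the
> interaction part of the Hamiltonian separately" [Mielke 1999, §2]; "When we introduce the Hubbard
> interaction `H_int`, the energy of the ferromagnetic ground states (of `H_hop`) do not change since
> ferromagnetic states do not feel on-site repulsion" [Tasaki 1998, §6.6].

**Results (all proved, no named facts).** For a Gram hopping `T = t Σ_a |u_a⟩⟨u_a| ≥ 0`, `t > 0`,
`U > 0`, and every `N ≤ N_d = dim 𝒦` (`𝒦` the flat band): `E₀(N) = 0` and there is a ground state in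
the sector `(N↑, 0↓)` with `S² ψ = (N/2)(N/2 + 1) ψ` — the product `Π_{k ∈ L} C†_↑(ν^k)|0⟩` over `N`
vectors of Mielke's basis (`exists_saturated_groundState_of_normalForm`, `exists_saturated_groundState`).
Transported to line graphs (`E₀(N) = -2t N` for `N ≤ M(G)`, `lineGraph_exists_saturated_groundState`)
and to the kagomé torus (`E₀(N) = -2t N` for `N ≤ L² + 1`, `kagome_exists_saturated_groundState`,
[Mielke 1992]). For `N < N_d` these ground states coexist with non-ferromagnetic ones in general (the
uniqueness statement is special to `N_e = N_d`, resp. to Mielke's §5 stability criterion, not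
formalised).

## References

* A. Mielke, J. Phys. A **32** (1999) 8411 = arXiv:cond-mat/9910385, abstract and §2 [Mielke1999]
  (held text pp. 2, 4).
* A. Mielke, J. Phys. A **24** (1991) 3311 [Mielke1991b]; J. Phys. A **25** (1992) 4335 [Mielke1992].
* H. Tasaki, Prog. Theor. Phys. **99** (1998) 489 = arXiv:cond-mat/9712219, §6.6 [Tasaki1998PTP]
  (held text p. 22).
-/

noncomputable section

open Matrix Finset Module Literature.Probability.LatticeModels
open scoped ComplexOrder

namespace Literature.MathematicalPhysics.QuantumLattice

namespace FlatBand

variable {Λ : Type*} [LinearOrder Λ] [Fintype Λ]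

/-! ### Weighted normal form: the product states over part of `D` -/

section NormalForm

variable {D : Finset Λ} {w : Λ → Λ → ℝ}

/-- A product state `Π_{k ∈ L} C†_↑(ν^k)|0⟩` in the sector `(N↑, 0↓)` is a highest-weight vector of
spin `N/2`: `S² ψ = (N/2)(N/2+1) ψ`. [cite: Mielke1999, §3 (`ψ_{0F}` "with `S = S_3 = N_d/2`")] -/
theorem spinSq_mulVec_of_isInSector_zero {N : ℕ} {ψ : Fock (Orb Λ)} (hS : IsInSector N 0 ψ) :
    spinSq *ᵥ ψ = ((((N : ℝ) / 2) * ((N : ℝ) / 2 + 1) : ℝ) : ℂ) • ψ := by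
  have h3 := LiebTwo.isSu2Triple_spin (Λ := Λ)
  have hZ : HubbardWave0.spinZ *ᵥ ψ = ((N : ℂ) / 2) • ψ := by
    rw [LiebThm1.spinZ_mulVec_of_isInSector hS]; congr 1; push_cast; ring
  have hP : spinPlus *ᵥ ψ = 0 := LiebThm1.raisesSpin_spinPlus.mulVec_eq_zero hS
  have h := su2Casimir_lower_pow h3 hP hZ 0
  rw [pow_zero, one_mulVec, LiebTwo.su2Casimir_spin_eq_spinSq] at h
  rw [h]; congr 1; push_cast; ring

/-- **Saturated ferromagnetic ground states for `N ≤ N_d` (weighted normal form).** For a Gram family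
whose hopping vectors span the same space as the normal-form vectors `w_x` (`x ∉ D`), `t > 0`, `U > 0`
and every `N ≤ |D|`: `E₀(N) = 0`, attained by the product state `Π_{k ∈ L} C†_↑(ν^k)|0⟩` over the first
`N` sites `L ⊆ D`, which lies in the sector `(N↑, 0↓)` and has `S² = (N/2)(N/2+1)`.
[cite: Mielke1999, §2 ("Any multi particle state that contains only electron with spin up in single
particle states `φ^i`, `i ≤ N_d` is a ground state … of the kinetic part and of the interaction part
of the Hamiltonian separately")] [cite: Tasaki1998PTP, §6.6] -/
theorem exists_saturated_groundState_of_normalForm {ι : Type*} (A : Finset ι) (u : ι → Λ → ℝ)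
    {t U : ℝ} (hw0 : ∀ x, x ∉ D → w x x ≠ 0) (hwD : ∀ x, x ∉ D → ∀ y, y ≠ x → y ∉ D → w x y = 0)
    (hspan : Submodule.span ℝ (u '' (A : Set ι)) = Submodule.span ℝ (w '' ((Dᶜ : Finset Λ) : Set Λ)))
    (ht : 0 < t) (hU : 0 < U) {N : ℕ} (hN : N ≤ D.card) :
    groundEnergy (gramHamiltonian A u t U) N = 0 ∧
      ∃ ψ : Fock (Orb Λ), IsGroundState (gramHamiltonian A u t U) N ψ ∧ IsInSector N 0 ψ ∧
        spinSq *ᵥ ψ = ((((N : ℝ) / 2) * ((N : ℝ) / 2 + 1) : ℝ) : ℂ) • ψ := by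
  classical
  -- the first `N` sites of `D`
  have hLD : ∀ k ∈ (D.sort (· ≤ ·)).take N, k ∈ D := fun k hk =>
    (Finset.mem_sort _).1 (List.mem_of_mem_take hk)
  have hLnd : ((D.sort (· ≤ ·)).take N).Nodup := (D.sort_nodup _).sublist (List.take_sublist _ _)
  have hLlen : ((D.sort (· ≤ ·)).take N).length = N := by
    rw [List.length_take, Finset.length_sort]; exact min_eq_left hN
  -- the product state
  have hS : IsInSector N 0 (wLocProd D w ((D.sort (· ≤ ·)).take N)) := by
    have := isInSector_wLocProd (D := D) (w := w) ((D.sort (· ≤ ·)).take N)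
    rwa [hLlen] at this
  have hG := isGutzwiller_wLocProd (D := D) (w := w) ((D.sort (· ≤ ·)).take N)
  have hK : ∀ x, x ∉ D → ∀ σ : Fin 2, fieldAnn (w x) σ *ᵥ wLocProd D w ((D.sort (· ≤ ·)).take N) = 0 :=
    fun x hx σ => fieldAnn_w_mulVec_wLocProd hw0 hwD hx σ hLD
  have h0 : wLocProd D w ((D.sort (· ≤ ·)).take N) ≠ 0 := fun h => by
    have := wLocProd_apply_pairSet_ne_zero (D := D) (w := w) hLnd hLD
    rw [h] at this
    exact this rfl
  have hψN : IsNParticle N (wLocProd D w ((D.sort (· ≤ ·)).take N)) := by simpa using hS.isNParticle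
  -- zero energy: kernel conditions in the `w`-basis + no double occupancy
  have hψH : gramHamiltonian A u t U *ᵥ wLocProd D w ((D.sort (· ≤ ·)).take N) = 0 := by
    rw [gramHamiltonian_mulVec_eq_zero_iff A u ht hU]
    refine ⟨fun a ha σ => ?_, hG⟩
    have hiff := forall_fieldAnn_mulVec_eq_zero_iff_of_span_eq hspan σ
      (wLocProd D w ((D.sort (· ≤ ·)).take N))
    exact (hiff.2 fun x hx => hK x (Finset.mem_compl.1 hx) σ) a ha
  have hE0 := groundEnergy_gramHamiltonian_eq_zero A u ht.le hU.le hψN h0 hψH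
  exact ⟨hE0, _, (isGroundState_gram_iff_of_groundEnergy_eq_zero A u t U hE0 _).2 ⟨hψN, h0, hψH⟩, hS,
    spinSq_mulVec_of_isInSector_zero hS⟩

end NormalForm

/-! ### Gram hoppings: every `N ≤ N_d = dim 𝒦` -/

section Gram

variable {ι : Type*} (A : Finset ι) (u : ι → Λ → ℝ) {t U : ℝ}

/-- **Saturated ferromagnetic ground states for `N_e ≤ N_d`** [Mielke 1999, abstract and §2]. For the
Hubbard model with the Gram hopping `T = t Σ_a |u_a⟩⟨u_a|` (`t > 0`), any `U > 0` and every electron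
number `N ≤ N_d = dim 𝒦`: the ground-state energy is `0` and there is a ground state with all spins
up (`S^z = S = N/2`, `S² ψ = (N/2)(N/2+1) ψ`) — no irreducibility needed. (Uniqueness holds only at
`N = N_d` under irreducibility, `mielke_flatBand_ferromagnetism`; for `N < N_d` non-ferromagnetic ground
states coexist in general.) [cite: Mielke1999, §2 ("Any multi particle state that contains only
electron with spin up in single particle states `φ^i`, `i ≤ N_d` is a ground state")]
[cite: Tasaki1998PTP, §6.6] -/
theorem exists_saturated_groundState (ht : 0 < t) (hU : 0 < U) {N : ℕ}
    (hN : N ≤ finrank ℝ (flatBand A u)) :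
    groundEnergy (gramHamiltonian A u t U) N = 0 ∧
      ∃ ψ : Fock (Orb Λ), IsGroundState (gramHamiltonian A u t U) N ψ ∧ IsInSector N 0 ψ ∧
        spinSq *ᵥ ψ = ((((N : ℝ) / 2) * ((N : ℝ) / 2 + 1) : ℝ) : ℂ) • ψ := by
  classical
  obtain ⟨D, ψ, hcard, hψK, hψD, hexp⟩ := exists_mielkeBasis (flatBand A u)
  have hw0 : ∀ x, x ∉ D → mielkeVec D ψ x x ≠ 0 := fun x _ => by
    rw [mielkeVec_self]; exact one_ne_zero
  have hwD : ∀ x, x ∉ D → ∀ y, y ≠ x → y ∉ D → mielkeVec D ψ x y = 0 :=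
    fun x _ y hyx hy => mielkeVec_of_notMem hyx hy
  exact exists_saturated_groundState_of_normalForm (D := D) (w := mielkeVec D ψ) A u hw0 hwD
    (span_eq_span_mielkeVec hcard hψK hψD hexp) ht hU (hcard ▸ hN)

end Gram

/-! ### Line graphs: `E₀(N) = -2t N` for `N ≤ M(G)` -/

section LineGraph

variable {V : Type*} [Fintype V] [DecidableEq V] {ed : Λ → Sym2 V} {t U : ℝ}

/-- **Saturated ferromagnetic ground states of the line-graph Hubbard model for `N_e ≤ M(G)`**
[Mielke 1991b; Tasaki 1998, §6.6]: for `t > 0`, `U > 0` and every `N ≤ dim 𝒦` (the flat band of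
`L(G)` at `-2t`), the ground-state energy is `-2t N` (the bottom of the band times `N`: the
ferromagnetic flat-band states "do not feel on-site repulsion") and there is a ground state with all
spins up, `S² ψ = (N/2)(N/2+1) ψ`. [cite: Tasaki1998PTP, §6.6 ("the energy of the ferromagnetic
ground states (of `H_hop`) do not change")] [cite: Mielke1991b] [cite: Mielke1999, §2] -/
theorem lineGraph_exists_saturated_groundState (hnd : ∀ l, ¬ (ed l).IsDiag)
    (hinj : Function.Injective ed) (ht : 0 < t) (hU : 0 < U) {N : ℕ}
    (hN : N ≤ finrank ℝ (flatBand (univ : Finset V) (incVec ed))) :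
    groundEnergy (lineGraphHamiltonian ed t U) N = -(2 * t) * N ∧
      ∃ ψ : Fock (Orb Λ), IsGroundState (lineGraphHamiltonian ed t U) N ψ ∧ IsInSector N 0 ψ ∧
        spinSq *ᵥ ψ = ((((N : ℝ) / 2) * ((N : ℝ) / 2 + 1) : ℝ) : ℂ) • ψ := by
  obtain ⟨h1, ψ, hψ, hS, hspin⟩ := exists_saturated_groundState (univ : Finset V) (incVec ed) ht hU hN
  -- the flat band fits into the orbitals: `N ≤ |Λ| ≤ 2|Λ|`
  have hNle : N ≤ Fintype.card (Orb Λ) := by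
    have h := Submodule.finrank_le (flatBand (univ : Finset V) (incVec ed))
    rw [Module.finrank_fintype_fun_eq_card] at h
    have : Fintype.card Λ ≤ Fintype.card (Orb Λ) := by
      rw [show Fintype.card (Orb Λ) = Fintype.card Λ * 2 by simp [Orb, Fintype.card_prod]]
      omega
    omega
  rw [lineGraphHamiltonian_eq t U hnd hinj]
  refine ⟨?_, ψ, (isGroundState_add_smul_totalNumber_iff _ _ hNle ψ).2 hψ, hS, hspin⟩
  rw [groundEnergy_add_smul_totalNumber _ _ hNle, h1]; ring

end LineGraph

/-! ### The kagomé torus: `E₀(N) = -2t N` for `N ≤ L² + 1` -/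

section Kagome

variable {L : ℕ}

/-- **Saturated ferromagnetic ground states of the kagomé Hubbard model for `N_e ≤ L² + 1`**
[Mielke 1992]: on the kagomé torus with `L × L` unit cells (`L ≥ 2`), hopping `+t` (`t > 0`, the tree's
`hamiltonian (kagomeFermionGraph L) (-t) U`) and any `U > 0`, for every electron number `N ≤ L² + 1`
the ground-state energy is `-2t N` and there is a ground state with all spins up
(`S² ψ = (N/2)(N/2+1) ψ`). [cite: Mielke1992] [cite: Tasaki1998PTP, §6.6] [cite: Mielke1999, §2] -/
theorem kagome_exists_saturated_groundState (hL : 2 ≤ L) {t U : ℝ} (ht : 0 < t) (hU : 0 < U) {N : ℕ}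
    (hN : N ≤ L ^ 2 + 1) :
    groundEnergy (QuantumLattice.hamiltonian (kagomeFermionGraph L) (-t) U) N = -(2 * t) * N ∧
      ∃ ψ : Fock (Orb (KagomeFermionVertex L)),
        IsGroundState (QuantumLattice.hamiltonian (kagomeFermionGraph L) (-t) U) N ψ ∧ IsInSector N 0 ψ ∧
          spinSq *ᵥ ψ = ((((N : ℝ) / 2) * ((N : ℝ) / 2 + 1) : ℝ) : ℂ) • ψ := by
  haveI : NeZero L := ⟨by omega⟩
  have hN' : N ≤ finrank ℝ (flatBand (univ : Finset (HexTorusVertex L)) (incVec (kagomeEd (L := L)))) := by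
    rw [finrank_kagome_flatBand hL]; exact hN
  have h := lineGraph_exists_saturated_groundState (ed := kagomeEd (L := L)) kagomeEd_not_isDiag
    (kagomeEd_injective hL) ht hU hN'
  rwa [lineGraphHamiltonian_kagomeEd] at h

end Kagome

end FlatBand

end Literature.MathematicalPhysics.QuantumLattice
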